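import Summits.MatrixMultiplication.MatrixMultiplication.Theorems.SaturationLadderLevelOneLaw

/-!
# Level-1 rectangular `CW_q` bound, all six patterns — II: integer certificates and the threshold (route `SaturationLadder`, lens 1, gen 20)

Part II of three (cell `decomp-mm`, lens 1, gen 20).  No definitions, no named facts, no sorry.
* §3 `entropyCert_of_nat`: the INTEGER certificate `(q+2)^{N₀} u₀^{u₀} u₁^{u₁} u₂^{u₂} ≤ N₀^{N₀} q^x`
  (`u₀+u₁+u₂ = N₀`) is exactly `log(q+2) − x log q / N₀ ≤ H_nats(u/N₀) = log 2 · H(u/N₀)`; and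
  `sixEntropy`: the three certificates for the marginals `X = (n₂+n₅+n₆, n₁+n₃, n₄)`,
  `Y = (n₃+n₄+n₆, n₁+n₂, n₅)`, `Z = (n₁+n₄+n₅, n₂+n₃, n₆)` of the type give
  `log(q+2) − x log q / N₀ ≤ log 2 · (min_m H(P_m) − Γ_S(P))` (zero penalty from part I).
* §4 `sixThreshold`: the analytic threshold with a general rate — `N = (q+2) N₀ m`, `M = (q+2) m`,
  `N (log(q+2) − x log q/N₀) + x M log q = N log(q+2)` exactly, so only the subexponential loss is
  absorbed into `(q^M)^δ` (`loss_le_exp'`, `exists_nat_forall_sqrt_le`; the proof of `famThreshold`).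

References: Coppersmith–Winograd 1990 §6 [CoppersmithWinograd1990]; Bürgisser–Clausen–Shokrollahi 1997
§15.8 [BurgisserClausenShokrollahi1997]; Le Gall 2014 App. A [LeGall2014].
-/

set_option linter.dupNamespace false
-- (single-conjunct summit: the namespace repeats `MatrixMultiplication`)

noncomputable section

open Finset
open scoped BigOperators

namespace Summit.MatrixMultiplication.MatrixMultiplication.Theorems.SaturationLadderLevelOne

open Literature.Computability.AlgebraicComplexity
open Literature.Barriers.MatrixMultiplication
open Summit.MatrixMultiplication.MatrixMultiplication.Theorems.PerfectAmortisation
open Summit.MatrixMultiplication.MatrixMultiplication.Theorems.SaturationLadderExpSaturation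

/-! ## §3 Layer B2 — from the integer certificates to the entropy bound -/

/-- `(u : ℝ)^u > 0` for every natural `u` (`0^0 = 1`). [folklore] -/
theorem pow_self_pos' (u : ℕ) : (0 : ℝ) < (u : ℝ) ^ u := by
  rcases Nat.eq_zero_or_pos u with rfl | hu
  · simp
  · have : (0 : ℝ) < u := by exact_mod_cast hu
    positivity

/-- `η(u/N) = (u log N − u log u)/N` (`η = negMulLog`, also for `u = 0`). [folklore] -/
theorem negMulLog_div_nat (u N : ℕ) (hN : 0 < N) :
    Real.negMulLog ((u : ℝ) / N) = ((u : ℝ) * Real.log N - (u : ℝ) * Real.log u) / N := by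
  have hN0 : (0 : ℝ) < N := by exact_mod_cast hN
  rcases Nat.eq_zero_or_pos u with rfl | hu
  · simp [Real.negMulLog]
  · have hu0 : (0 : ℝ) < u := by exact_mod_cast hu
    rw [Real.negMulLog, Real.log_div hu0.ne' hN0.ne']
    field_simp
    ring

/-- `log 2 · H(a, b, c) = η(a) + η(b) + η(c)` (bits to nats). [folklore] -/
theorem log_two_mul_shannonEntropy_vec3 (a b c : ℝ) :
    Real.log 2 * shannonEntropy ![a, b, c] = Real.negMulLog a + Real.negMulLog b + Real.negMulLog c := by
  have hlog : 0 < Real.log 2 := Real.log_pos one_lt_two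
  rw [shannonEntropy_def, mul_div_cancel₀ _ hlog.ne', Fin.sum_univ_three]
  simp only [Matrix.cons_val_zero, Matrix.cons_val_one, Matrix.cons_val_two, Matrix.head_cons,
    Matrix.tail_cons]

/-- **The integer certificate implies the entropy certificate**: for `u₀ + u₁ + u₂ = N₀ ≥ 1`, `q ≥ 1`,
`(q+2)^{N₀} u₀^{u₀} u₁^{u₁} u₂^{u₂} ≤ N₀^{N₀} q^x` gives `log(q+2) − x log q / N₀ ≤ log 2 · H(u/N₀)`
(`= H_nats(u/N₀) = log N₀ − (∑ uᵢ log uᵢ)/N₀`). [folklore] -/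
theorem entropyCert_of_nat {q N₀ u₀ u₁ u₂ x : ℕ} (hq : 1 ≤ q) (hN : 1 ≤ N₀) (hu : u₀ + u₁ + u₂ = N₀)
    (h : (q + 2) ^ N₀ * (u₀ ^ u₀ * u₁ ^ u₁ * u₂ ^ u₂) ≤ N₀ ^ N₀ * q ^ x) :
    Real.log ((q : ℝ) + 2) - (x : ℝ) * Real.log q / N₀ ≤
      Real.log 2 * shannonEntropy ![(u₀ : ℝ) / N₀, (u₁ : ℝ) / N₀, (u₂ : ℝ) / N₀] := by
  have hN0 : (0 : ℝ) < N₀ := by exact_mod_cast hN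
  have hq0 : (0 : ℝ) < q := by exact_mod_cast hq
  have hq2 : (0 : ℝ) < (q : ℝ) + 2 := by linarith
  have h0 := pow_self_pos' u₀
  have h1 := pow_self_pos' u₁
  have h2 := pow_self_pos' u₂
  -- the certificate over `ℝ`, in logarithms
  have h' : ((q : ℝ) + 2) ^ N₀ * ((u₀ : ℝ) ^ u₀ * (u₁ : ℝ) ^ u₁ * (u₂ : ℝ) ^ u₂) ≤
      (N₀ : ℝ) ^ N₀ * (q : ℝ) ^ x := by exact_mod_cast h
  have hlog := Real.log_le_log (by positivity) h'
  rw [Real.log_mul (by positivity) (mul_pos (mul_pos h0 h1) h2).ne',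
    Real.log_mul (mul_pos h0 h1).ne' h2.ne', Real.log_mul h0.ne' h1.ne',
    Real.log_mul (by positivity) (by positivity), Real.log_pow, Real.log_pow, Real.log_pow,
    Real.log_pow, Real.log_pow, Real.log_pow] at hlog
  -- the entropy in closed form
  have hsum : (u₀ : ℝ) + u₁ + u₂ = N₀ := by exact_mod_cast hu
  have hH : Real.log 2 * shannonEntropy ![(u₀ : ℝ) / N₀, (u₁ : ℝ) / N₀, (u₂ : ℝ) / N₀] =
      ((N₀ : ℝ) * Real.log N₀ -
        ((u₀ : ℝ) * Real.log u₀ + (u₁ : ℝ) * Real.log u₁ + (u₂ : ℝ) * Real.log u₂)) / N₀ := by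
    rw [log_two_mul_shannonEntropy_vec3, negMulLog_div_nat u₀ N₀ hN, negMulLog_div_nat u₁ N₀ hN,
      negMulLog_div_nat u₂ N₀ hN, ← hsum]
    field_simp
    ring
  have e1 : Real.log ((q : ℝ) + 2) - (x : ℝ) * Real.log q / N₀ =
      ((N₀ : ℝ) * Real.log ((q : ℝ) + 2) - (x : ℝ) * Real.log q) / N₀ := by
    field_simp
  rw [hH, e1]
  exact div_le_div_of_nonneg_right (by linarith) hN0.le

/-- **Entropy layer (six patterns).**  For `P = Q/N` as in `sixDiagonalRaw`, the three integer
certificates give `log(q+2) − x log q / N₀ ≤ log 2 · (min_m H(P_m) − Γ_S(P))`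
(marginals `marginalDist_six`, `Γ_S(P) ≤ 0` by `maxEntropyPenalty_six_nonpos`). [folklore] -/
theorem sixEntropy (q n₁ n₂ n₃ n₄ n₅ n₆ x m : ℕ) (hq : 2 ≤ q) (hN : 1 ≤ n₁ + n₂ + n₃ + n₄ + n₅ + n₆)
    (hm : 1 ≤ m)
    (hX : (q + 2) ^ (n₁ + n₂ + n₃ + n₄ + n₅ + n₆) *
        ((n₂ + n₅ + n₆) ^ (n₂ + n₅ + n₆) * (n₁ + n₃) ^ (n₁ + n₃) * n₄ ^ n₄) ≤
      (n₁ + n₂ + n₃ + n₄ + n₅ + n₆) ^ (n₁ + n₂ + n₃ + n₄ + n₅ + n₆) * q ^ x)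
    (hY : (q + 2) ^ (n₁ + n₂ + n₃ + n₄ + n₅ + n₆) *
        ((n₃ + n₄ + n₆) ^ (n₃ + n₄ + n₆) * (n₁ + n₂) ^ (n₁ + n₂) * n₅ ^ n₅) ≤
      (n₁ + n₂ + n₃ + n₄ + n₅ + n₆) ^ (n₁ + n₂ + n₃ + n₄ + n₅ + n₆) * q ^ x)
    (hZ : (q + 2) ^ (n₁ + n₂ + n₃ + n₄ + n₅ + n₆) *
        ((n₁ + n₄ + n₅) ^ (n₁ + n₄ + n₅) * (n₂ + n₃) ^ (n₂ + n₃) * n₆ ^ n₆) ≤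
      (n₁ + n₂ + n₃ + n₄ + n₅ + n₆) ^ (n₁ + n₂ + n₃ + n₄ + n₅ + n₆) * q ^ x)
    (P : Fin 3 × Fin 3 × Fin 3 → ℝ)
    (hP : ∀ s, P s = ((if s = (1, 1, 0) then (q + 2) * m * n₁ else if s = (0, 1, 1) then (q + 2) * m * n₂
        else if s = (1, 0, 1) then (q + 2) * m * n₃ else if s = (2, 0, 0) then (q + 2) * m * n₄
        else if s = (0, 2, 0) then (q + 2) * m * n₅ else if s = (0, 0, 2) then (q + 2) * m * n₆
        else 0 : ℕ) : ℝ) / ((((q + 2) * (n₁ + n₂ + n₃ + n₄ + n₅ + n₆) * m : ℕ)) : ℝ)) :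
    Real.log ((q : ℝ) + 2) - (x : ℝ) * Real.log q / ((n₁ + n₂ + n₃ + n₄ + n₅ + n₆ : ℕ) : ℝ) ≤
      Real.log 2 * (min (shannonEntropy (marginalDist₁ P))
        (min (shannonEntropy (marginalDist₂ P)) (shannonEntropy (marginalDist₃ P))) -
        maxEntropyPenalty cwSupport₃ P) := by
  set N₀ : ℕ := n₁ + n₂ + n₃ + n₄ + n₅ + n₆ with hN₀
  have hN0 : (0 : ℝ) < N₀ := by exact_mod_cast hN
  have hq0 : (0 : ℝ) < q := by exact_mod_cast (by omega : 0 < q)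
  have hm0 : (0 : ℝ) < m := by exact_mod_cast hm
  have hq2 : (0 : ℝ) < (q : ℝ) + 2 := by linarith
  -- the law as probabilities `pᵢ = nᵢ / N₀`
  have hPp : ∀ s, P s = if s = (1, 1, 0) then (n₁ : ℝ) / N₀ else if s = (0, 1, 1) then (n₂ : ℝ) / N₀
      else if s = (1, 0, 1) then (n₃ : ℝ) / N₀ else if s = (2, 0, 0) then (n₄ : ℝ) / N₀
      else if s = (0, 2, 0) then (n₅ : ℝ) / N₀ else if s = (0, 0, 2) then (n₆ : ℝ) / N₀ else 0 := by
    intro s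
    rw [hP s]
    push_cast
    split_ifs <;> first | (field_simp; ring) | field_simp
  obtain ⟨hm₁, hm₂, hm₃⟩ := marginalDist_six hPp
  have hsum1 : (n₁ : ℝ) / N₀ + (n₂ : ℝ) / N₀ + (n₃ : ℝ) / N₀ + (n₄ : ℝ) / N₀ + (n₅ : ℝ) / N₀ +
      (n₆ : ℝ) / N₀ = 1 := by
    have e : ((n₁ : ℝ) + n₂ + n₃ + n₄ + n₅ + n₆) = N₀ := by rw [hN₀]; push_cast; ring
    field_simp
    linarith
  have hpen : maxEntropyPenalty cwSupport₃ P ≤ 0 :=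
    maxEntropyPenalty_six_nonpos hPp (by positivity) (by positivity) (by positivity) (by positivity)
      (by positivity) (by positivity) hsum1
  have hq1 : 1 ≤ q := by omega
  -- the three certificates
  have cX := entropyCert_of_nat (x := x) hq1 hN (by rw [hN₀]; ring) hX
  have cY := entropyCert_of_nat (x := x) hq1 hN (by rw [hN₀]; ring) hY
  have cZ := entropyCert_of_nat (x := x) hq1 hN (by rw [hN₀]; ring) hZ
  have eX : (![(((n₂ + n₅ + n₆ : ℕ)) : ℝ) / N₀, (((n₁ + n₃ : ℕ)) : ℝ) / N₀, (n₄ : ℝ) / N₀] : Fin 3 → ℝ) =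
      ![(n₂ : ℝ) / N₀ + (n₅ : ℝ) / N₀ + (n₆ : ℝ) / N₀, (n₁ : ℝ) / N₀ + (n₃ : ℝ) / N₀, (n₄ : ℝ) / N₀] := by
    push_cast
    rw [add_div, add_div, add_div]
  have eY : (![(((n₃ + n₄ + n₆ : ℕ)) : ℝ) / N₀, (((n₁ + n₂ : ℕ)) : ℝ) / N₀, (n₅ : ℝ) / N₀] : Fin 3 → ℝ) =
      ![(n₃ : ℝ) / N₀ + (n₄ : ℝ) / N₀ + (n₆ : ℝ) / N₀, (n₁ : ℝ) / N₀ + (n₂ : ℝ) / N₀, (n₅ : ℝ) / N₀] := by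
    push_cast
    rw [add_div, add_div, add_div]
  have eZ : (![(((n₁ + n₄ + n₅ : ℕ)) : ℝ) / N₀, (((n₂ + n₃ : ℕ)) : ℝ) / N₀, (n₆ : ℝ) / N₀] : Fin 3 → ℝ) =
      ![(n₁ : ℝ) / N₀ + (n₄ : ℝ) / N₀ + (n₅ : ℝ) / N₀, (n₂ : ℝ) / N₀ + (n₃ : ℝ) / N₀, (n₆ : ℝ) / N₀] := by
    push_cast
    rw [add_div, add_div, add_div]
  rw [eX] at cX
  rw [eY] at cY
  rw [eZ] at cZ
  rw [hm₁, hm₂, hm₃]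
  have hlog : 0 < Real.log 2 := Real.log_pos one_lt_two
  have hmin : Real.log ((q : ℝ) + 2) - (x : ℝ) * Real.log q / N₀ ≤
      Real.log 2 * min (shannonEntropy ![(n₂ : ℝ) / N₀ + (n₅ : ℝ) / N₀ + (n₆ : ℝ) / N₀,
          (n₁ : ℝ) / N₀ + (n₃ : ℝ) / N₀, (n₄ : ℝ) / N₀])
        (min (shannonEntropy ![(n₃ : ℝ) / N₀ + (n₄ : ℝ) / N₀ + (n₆ : ℝ) / N₀,
            (n₁ : ℝ) / N₀ + (n₂ : ℝ) / N₀, (n₅ : ℝ) / N₀])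
          (shannonEntropy ![(n₁ : ℝ) / N₀ + (n₄ : ℝ) / N₀ + (n₅ : ℝ) / N₀,
            (n₂ : ℝ) / N₀ + (n₃ : ℝ) / N₀, (n₆ : ℝ) / N₀])) := by
    rw [mul_min_of_nonneg _ _ hlog.le, mul_min_of_nonneg _ _ hlog.le]
    exact le_min cX (le_min cY cZ)
  have h2 : Real.log 2 * maxEntropyPenalty cwSupport₃ P ≤ 0 :=
    mul_nonpos_of_nonneg_of_nonpos hlog.le hpen
  rw [mul_sub]
  linarith

/-! ## §4 Layer C — the analytic threshold with a general rate -/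

/-- **Analytic threshold (general rate).**  For `q ≥ 2`, `N₀ ≥ 1`, `x : ℝ`, `δ > 0` there is `m ≥ 1`
such that, with `N = (q+2) N₀ m` and `M = (q+2) m`, every `V : ℕ` with
`exp(N · (log(q+2) − x log q / N₀)) ≤ V · (N+1)^63 · 192 · exp(4 √(log 6 + N log 27))` satisfies
`(q+2)^N ≤ V · (q^M)^(x + δ)`: `N (log(q+2) − x log q/N₀) + x M log q = N log(q+2)` exactly, so only
the subexponential loss is absorbed into `(q^M)^δ` (`loss_le_exp'`, `exists_nat_forall_sqrt_le`; the
proof of the lineage's `famThreshold` with a general rate). [folklore] -/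
theorem sixThreshold (q N₀ : ℕ) (hq : 2 ≤ q) (hN₀ : 1 ≤ N₀) (x : ℝ) :
    ∀ δ : ℝ, 0 < δ → ∃ m : ℕ, 1 ≤ m ∧ ∀ V : ℕ,
      Real.exp (((((q + 2) * N₀ * m : ℕ)) : ℝ) *
          (Real.log ((q : ℝ) + 2) - x * Real.log (q : ℝ) / N₀)) ≤
          (V : ℝ) * ((((((q + 2) * N₀ * m : ℕ)) : ℝ)) + 1) ^ 63 * 192 *
            Real.exp (4 * Real.sqrt (Real.log 6 + ((((q + 2) * N₀ * m : ℕ)) : ℝ) * Real.log 27)) →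
      ((q : ℝ) + 2) ^ ((q + 2) * N₀ * m) ≤ (V : ℝ) * ((q : ℝ) ^ ((q + 2) * m)) ^ (x + δ) := by
  intro δ hδ
  have hq0 : (0 : ℝ) < q := by exact_mod_cast (by omega : 0 < q)
  have hq1 : (1 : ℝ) < q := by exact_mod_cast (by omega : 1 < q)
  have hk0 : (0 : ℝ) < N₀ := by exact_mod_cast hN₀
  have hk1 : (1 : ℝ) ≤ N₀ := by exact_mod_cast hN₀
  have hq2 : (0 : ℝ) < (q : ℝ) + 2 := by linarith
  have hL : 0 < Real.log (q : ℝ) := Real.log_pos hq1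
  have hκ : 0 < δ * ((q : ℝ) + 2) * Real.log (q : ℝ) := by positivity
  -- the threshold
  set c₀ : ℝ := (126 * √((q : ℝ) + 3) + 4 * √(Real.log 6 + ((q : ℝ) + 2) * Real.log 27)) *
    √(N₀ : ℝ) with hc₀
  obtain ⟨m₀, hm₀⟩ := exists_nat_forall_sqrt_le c₀ (Real.log 192) (δ * ((q : ℝ) + 2) * Real.log (q : ℝ)) hκ
  obtain ⟨m, hm1, hmm⟩ : ∃ m : ℕ, 1 ≤ m ∧
      c₀ * √(m : ℝ) + Real.log 192 ≤ δ * ((q : ℝ) + 2) * Real.log (q : ℝ) * m :=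
    ⟨max m₀ 1, le_max_right _ _, hm₀ _ (le_max_left _ _)⟩
  refine ⟨m, hm1, fun V hV => ?_⟩
  have hm0 : (0 : ℝ) < m := by exact_mod_cast hm1
  have hM1 : (1 : ℝ) ≤ (N₀ : ℝ) * m := by
    have : (1 : ℝ) ≤ m := by exact_mod_cast hm1
    nlinarith
  have hN : ((((q + 2) * N₀ * m : ℕ)) : ℝ) = ((q : ℝ) + 2) * ((N₀ : ℝ) * m) := by push_cast; ring
  rw [hN] at hV
  set h : ℝ := Real.log ((q : ℝ) + 2) - x * Real.log (q : ℝ) / N₀ with hh_def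
  -- Step 1: the loss is at most `exp (δ (q+2) m log q)`, hence `exp (N h) ≤ V exp (δ (q+2) m log q)`
  have hbound : (126 * √((q : ℝ) + 3) + 4 * √(Real.log 6 + ((q : ℝ) + 2) * Real.log 27)) *
      √((N₀ : ℝ) * m) + Real.log 192 ≤
        δ * ((q : ℝ) + 2) * Real.log (q : ℝ) / N₀ * ((N₀ : ℝ) * m) := by
    have e1 : (126 * √((q : ℝ) + 3) + 4 * √(Real.log 6 + ((q : ℝ) + 2) * Real.log 27)) *
        √((N₀ : ℝ) * m) = c₀ * √(m : ℝ) := by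
      rw [hc₀, Real.sqrt_mul hk0.le]
      ring
    have e2 : δ * ((q : ℝ) + 2) * Real.log (q : ℝ) / N₀ * ((N₀ : ℝ) * m) =
        δ * ((q : ℝ) + 2) * Real.log (q : ℝ) * m := by
      field_simp
    rw [e1, e2]
    exact hmm
  have hloss := loss_le_exp' hq0.le hM1 hbound
  have eκ : δ * ((q : ℝ) + 2) * Real.log (q : ℝ) / N₀ * ((N₀ : ℝ) * m) =
      δ * ((q : ℝ) + 2) * Real.log (q : ℝ) * m := by
    field_simp
  rw [eκ] at hloss
  have hmain : Real.exp (((q : ℝ) + 2) * ((N₀ : ℝ) * m) * h) ≤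
      (V : ℝ) * Real.exp (δ * ((q : ℝ) + 2) * Real.log (q : ℝ) * m) :=
    calc Real.exp (((q : ℝ) + 2) * ((N₀ : ℝ) * m) * h)
        ≤ (V : ℝ) * (((q : ℝ) + 2) * ((N₀ : ℝ) * m) + 1) ^ 63 * 192 *
            Real.exp (4 * √(Real.log 6 + ((q : ℝ) + 2) * ((N₀ : ℝ) * m) * Real.log 27)) := hV
      _ = (V : ℝ) * ((((q : ℝ) + 2) * ((N₀ : ℝ) * m) + 1) ^ 63 * 192 *
            Real.exp (4 * √(Real.log 6 + ((q : ℝ) + 2) * ((N₀ : ℝ) * m) * Real.log 27))) := by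
          rw [mul_assoc (V : ℝ), mul_assoc (V : ℝ)]
      _ ≤ (V : ℝ) * Real.exp (δ * ((q : ℝ) + 2) * Real.log (q : ℝ) * m) :=
          mul_le_mul_of_nonneg_left hloss (Nat.cast_nonneg V)
  -- Step 2: `(q+2)^N = exp (N h) · exp (x M log q)` and
  -- `(q^M)^(x+δ) = exp (δ M log q) · exp (x M log q)`, `M = (q+2) m`
  have hqM : (0 : ℝ) < (q : ℝ) ^ ((q + 2) * m) := by positivity
  have h10 : ((q : ℝ) + 2) ^ ((q + 2) * N₀ * m) =
      Real.exp (((q : ℝ) + 2) * ((N₀ : ℝ) * m) * h) *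
        Real.exp (x * (((q : ℝ) + 2) * m) * Real.log q) := by
    rw [← Real.exp_add, ← Real.exp_log (by positivity : (0 : ℝ) < ((q : ℝ) + 2) ^ ((q + 2) * N₀ * m)),
      Real.log_pow]
    congr 1
    rw [hh_def]
    push_cast
    field_simp
    ring
  have hexpq : ((q : ℝ) ^ ((q + 2) * m)) ^ (x + δ) =
      Real.exp (δ * ((q : ℝ) + 2) * Real.log (q : ℝ) * m) *
        Real.exp (x * (((q : ℝ) + 2) * m) * Real.log q) := by
    rw [Real.rpow_def_of_pos hqM, Real.log_pow, ← Real.exp_add]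
    congr 1
    push_cast
    ring
  rw [h10, hexpq, ← mul_assoc (V : ℝ)]
  exact mul_le_mul_of_nonneg_right hmain (Real.exp_pos _).le

end Summit.MatrixMultiplication.MatrixMultiplication.Theorems.SaturationLadderLevelOne

end
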